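import Summits.CriticalPhenomena.PercolationContinuityZ3.Theses.PercDustRigidity
import Literature.Probability.Percolation.HalfSpaceProofs
import Literature.Probability.Percolation.InsertionTolerance
import Literature.Probability.Percolation.DeletionTolerance
import Literature.Probability.Percolation.InequalitiesProofs
import Literature.Probability.Percolation.LatticeSymmetry
import Literature.Probability.Percolation.SiteConnectionTools
import Literature.Probability.Percolation.SharpnessDCTProofs
import Literature.Probability.Percolation.Crossings
import Literature.Probability.Percolation.RSW
import HarnessLib

/-!
# `PercDustRigidity.BernoulliEnergyFKGPortrait` (stmt-CriticalPhenomena-9596), settled: insertion and deletion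
# tolerance, Harris–FKG, and almost-sure finiteness of every half-space cluster at `p_c(ℤ³)`

RSW3 lane (cell `prim-rsw3`, prover P2, gen 31).  Closes the support item AS FILED.  Clauses: insertion
tolerance (`bondPercolation_pow_mul_real_preimage_openEdges_le`, constant `p_c^{|E(Λ_N)|}`, `p_c > 0`),
deletion tolerance (`bondPercolation_pow_mul_real_preimage_closeEdges_le`, constant `(1-p_c)^{|E(Λ_N)|}`,
`p_c < 1`), positive association (`harris_fkg_holds`, measure form), and: almost surely, for every
direction `i`, level `a` and vertex `v`, the open clusters of `v` inside the half-spaces `{a ≤ x_i}` and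
`{x_i ≤ a}` are finite.  The last clause is Barsky–Grimmett–Newman's `θ_ℍ(p_c) = 0`
(`BarskyGrimmettNewman1991_Z3_holds`, root on the boundary plane of `{0 ≤ x_0}`), moved to a root at depth
`t` by insertion tolerance along the segment from the plane to the root, and to every half-space by a
lattice automorphism (signed coordinate permutation followed by a shift).  Nothing here uses p205010.
-/

noncomputable section

namespace Summit.CriticalPhenomena.PercolationContinuityZ3.Theorems.BernoulliPortrait

open MeasureTheory Literature.Probability.Percolation Literature.Probability.LatticeModels

/-! ## Half-space clusters: the standard half-space `{0 ≤ x_0}` -/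

/-- The origin lies in the standard half-space. -/
private theorem zero_mem_H : (0 : Site 3) ∈ {x : Site 3 | 0 ≤ x 0} := by simp

/-- On a lattice configuration the `openConnIn`-cluster of `r ∈ S` is the constrained cluster
`openClusterIn (withinGraph ℤ³ S)`. -/
private theorem setOf_openConnIn_eq {S : Set (Site 3)} {r : Site 3} (hr : r ∈ S) {ω : BondConfig (Site 3)}
    (hω : ω ⊆ (zdGraph 3).edgeSet) :
    {y : Site 3 | ω ∈ openConnIn S r y} = openClusterIn (withinGraph (zdGraph 3) S) ω r := by
  ext y
  rw [Set.mem_setOf_eq, openConnIn_eq_openConnVia hr, openClusterIn_withinGraph_eq_top (zdGraph 3) S hω]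
  rfl

/-- Consecutive axis points differ by `e₀`. -/
private theorem axisPt_succ (t : ℕ) :
    (Pi.single 0 (((t + 1 : ℕ) : ℤ)) : Site 3) = (Pi.single 0 (t : ℤ) : Site 3) + Pi.single 0 1 := by
  ext j; by_cases hj : j = 0 <;> simp [hj]

/-- Axis points lie in the standard half-space. -/
private theorem axisPt_mem_H (t : ℕ) : (Pi.single 0 (t : ℤ) : Site 3) ∈ {x : Site 3 | 0 ≤ x 0} := by
  simp

/-- The segment consists of lattice edges. -/
private theorem segEdges_subset (t : ℕ) : (↑(((Finset.range t).image fun k => s((Pi.single 0 ((k : ℕ) : ℤ) : Site 3), (Pi.single 0 (((k + 1 : ℕ)) : ℤ) : Site 3)))) : Set (Sym2 (Site 3))) ⊆ (zdGraph 3).edgeSet := by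
  intro e he
  rw [Finset.mem_coe, Finset.mem_image] at he
  obtain ⟨k, -, rfl⟩ := he
  rw [SimpleGraph.mem_edgeSet, zdGraph_adj_iff]
  exact ⟨0, Or.inl (axisPt_succ k)⟩

/-- With the segment opened, `0` is joined to `t e₀` inside the half-space. -/
private theorem openConnIn_axisPt_of_segment (t : ℕ) (ω : BondConfig (Site 3)) :
    openEdges (↑(((Finset.range t).image fun k => s((Pi.single 0 ((k : ℕ) : ℤ) : Site 3), (Pi.single 0 (((k + 1 : ℕ)) : ℤ) : Site 3)))) : Set (Sym2 (Site 3))) ω ∈ openConnIn {x : Site 3 | 0 ≤ x 0} 0 ((Pi.single 0 ((t : ℕ) : ℤ) : Site 3)) := by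
  rw [mem_openConnIn_iff_pathIn]
  induction t with
  | zero =>
    have h0 : (Pi.single 0 ((0 : ℕ) : ℤ) : Site 3) = 0 := by simp
    rw [h0]
    exact PathIn.refl zero_mem_H
  | succ t ih =>
    have hmono : PathIn (openGraph (openEdges (↑(((Finset.range (t + 1)).image fun k => s((Pi.single 0 ((k : ℕ) : ℤ) : Site 3), (Pi.single 0 (((k + 1 : ℕ)) : ℤ) : Site 3)))) : Set (Sym2 (Site 3))) ω))
        {x : Site 3 | 0 ≤ x 0} 0 ((Pi.single 0 ((t : ℕ) : ℤ) : Site 3)) := by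
      refine ih.mono_graph ?_
      intro a b hab
      rw [openGraph_adj] at hab ⊢
      refine ⟨?_, hab.2⟩
      rcases hab.1 with h | h
      · exact Or.inl h
      · refine Or.inr ?_
        rw [Finset.mem_coe, Finset.mem_image] at h ⊢
        obtain ⟨k, hk, hke⟩ := h
        exact ⟨k, Finset.mem_range.2 (Nat.lt_succ_of_lt (Finset.mem_range.1 hk)), hke⟩
    refine hmono.tail ?_ (axisPt_mem_H (t + 1))
    rw [openGraph_adj]
    refine ⟨Or.inr ?_, ?_⟩
    · rw [Finset.mem_coe, Finset.mem_image]
      exact ⟨t, Finset.mem_range.2 (Nat.lt_succ_self t), rfl⟩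
    · intro h
      have := congrFun h 0
      simp at this

/-- **BGN at depth `t`** (Barsky–Grimmett–Newman at the root of the plane, insertion tolerance along the
segment): at `p_c(ℤ³)` the cluster of `t e₀` inside `{0 ≤ x_0}` is a.s. finite. -/
private theorem measure_bad_axisPt (t : ℕ) :
    bondPercolation (zdGraph 3) (criticalProbI 3)
      {ω | {y : Site 3 | ω ∈ openConnIn {x : Site 3 | 0 ≤ x 0} ((Pi.single 0 ((t : ℕ) : ℤ) : Site 3)) y}.Infinite} = 0 := by
  set μ := bondPercolation (zdGraph 3) (criticalProbI 3) with hμ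
  set H : Set (Site 3) := {x : Site 3 | 0 ≤ x 0} with hH
  set E₀ : Set (BondConfig (Site 3)) := percolatesVia (withinGraph (zdGraph 3) H) 0 with hE₀
  have hE₀m : MeasurableSet E₀ := measurableSet_percolatesVia _ _
  have hE₀null : μ.real E₀ = 0 := by
    rw [hμ, hE₀, hH, ← theta_induce_eq_real_percolatesVia (zdGraph 3) {x : Site 3 | 0 ≤ x 0} 0 zero_mem_H]
    exact BarskyGrimmettNewman1991_Z3_holds
  -- on lattice configurations the bad event is carried into `E₀` by opening the segment
  have hsub : ∀ᵐ ω ∂μ, ω ∈ {ω | {y : Site 3 | ω ∈ openConnIn H ((Pi.single 0 ((t : ℕ) : ℤ) : Site 3)) y}.Infinite} →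
      ω ∈ openEdges (↑(((Finset.range t).image fun k => s((Pi.single 0 ((k : ℕ) : ℤ) : Site 3), (Pi.single 0 (((k + 1 : ℕ)) : ℤ) : Site 3)))) : Set (Sym2 (Site 3))) ⁻¹' E₀ := by
    filter_upwards [ae_subset_edgeSet (zdGraph 3) (criticalProbI 3)] with ω hω hbad
    set ω' := openEdges (↑(((Finset.range t).image fun k => s((Pi.single 0 ((k : ℕ) : ℤ) : Site 3), (Pi.single 0 (((k + 1 : ℕ)) : ℤ) : Site 3)))) : Set (Sym2 (Site 3))) ω with hω'
    have hω'lat : ω' ⊆ (zdGraph 3).edgeSet := Set.union_subset hω (segEdges_subset t)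
    have hgrow : {y : Site 3 | ω ∈ openConnIn H ((Pi.single 0 ((t : ℕ) : ℤ) : Site 3)) y} ⊆ {y : Site 3 | ω' ∈ openConnIn H 0 y} := by
      intro y hy
      have h1 : ω' ∈ openConnIn H ((Pi.single 0 ((t : ℕ) : ℤ) : Site 3)) y := isUpperSet_openConnIn H ((Pi.single 0 ((t : ℕ) : ℤ) : Site 3)) y (subset_openEdges _ ω) hy
      have h0 : ω' ∈ openConnIn H 0 ((Pi.single 0 ((t : ℕ) : ℤ) : Site 3)) := openConnIn_axisPt_of_segment t ω
      rw [mem_openConnIn_iff_pathIn] at h0 h1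
      show ω' ∈ openConnIn H 0 y
      rw [mem_openConnIn_iff_pathIn]
      exact h0.trans h1
    have hinf : {y : Site 3 | ω' ∈ openConnIn H 0 y}.Infinite := Set.Infinite.mono hgrow hbad
    show (openClusterIn (withinGraph (zdGraph 3) H) ω' 0).Infinite
    rwa [← setOf_openConnIn_eq zero_mem_H hω'lat]
  have hle : μ.real {ω | {y : Site 3 | ω ∈ openConnIn H ((Pi.single 0 ((t : ℕ) : ℤ) : Site 3)) y}.Infinite} ≤
      μ.real (openEdges (↑(((Finset.range t).image fun k => s((Pi.single 0 ((k : ℕ) : ℤ) : Site 3), (Pi.single 0 (((k + 1 : ℕ)) : ℤ) : Site 3)))) : Set (Sym2 (Site 3))) ⁻¹' E₀) :=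
    ENNReal.toReal_mono (measure_ne_top _ _) (measure_mono_ae hsub)
  have hins := bondPercolation_pow_mul_real_preimage_openEdges_le (zdGraph 3) (criticalProbI 3) (((Finset.range t).image fun k => s((Pi.single 0 ((k : ℕ) : ℤ) : Site 3), (Pi.single 0 (((k + 1 : ℕ)) : ℤ) : Site 3))))
    (segEdges_subset t) hE₀m
  have hp0 : 0 < ((criticalProbI 3 : unitInterval) : ℝ) := by
    rw [coe_criticalProbI]; exact criticalProb_zd_pos 3 (by norm_num)
  have hpow : 0 < ((criticalProbI 3 : unitInterval) : ℝ) ^ (((Finset.range t).image fun k => s((Pi.single 0 ((k : ℕ) : ℤ) : Site 3), (Pi.single 0 (((k + 1 : ℕ)) : ℤ) : Site 3)))).card := pow_pos hp0 _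
  have hreal : μ.real {ω | {y : Site 3 | ω ∈ openConnIn H ((Pi.single 0 ((t : ℕ) : ℤ) : Site 3)) y}.Infinite} = 0 := by
    refine le_antisymm ?_ measureReal_nonneg
    have h1 : ((criticalProbI 3 : unitInterval) : ℝ) ^ (((Finset.range t).image fun k => s((Pi.single 0 ((k : ℕ) : ℤ) : Site 3), (Pi.single 0 (((k + 1 : ℕ)) : ℤ) : Site 3)))).card *
        μ.real {ω | {y : Site 3 | ω ∈ openConnIn H ((Pi.single 0 ((t : ℕ) : ℤ) : Site 3)) y}.Infinite} ≤ 0 := by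
      rw [← hE₀null]; exact (mul_le_mul_of_nonneg_left hle hpow.le).trans hins
    by_contra hneg
    push Not at hneg
    have : 0 < ((criticalProbI 3 : unitInterval) : ℝ) ^ (((Finset.range t).image fun k => s((Pi.single 0 ((k : ℕ) : ℤ) : Site 3), (Pi.single 0 (((k + 1 : ℕ)) : ℤ) : Site 3)))).card *
        μ.real {ω | {y : Site 3 | ω ∈ openConnIn H ((Pi.single 0 ((t : ℕ) : ℤ) : Site 3)) y}.Infinite} := mul_pos hpow hneg
    linarith
  exact (measureReal_eq_zero_iff (measure_ne_top _ _)).1 hreal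

/-! ## Transport to every half-space -/

/-- Null half-space-cluster events are carried by lattice automorphisms. -/
private theorem measure_bad_image (φ : zdGraph 3 ≃g zdGraph 3) {S : Set (Site 3)} {r : Site 3}
    (h : bondPercolation (zdGraph 3) (criticalProbI 3) {ω | {y : Site 3 | ω ∈ openConnIn S r y}.Infinite} = 0) :
    bondPercolation (zdGraph 3) (criticalProbI 3) {ω | {y : Site 3 | ω ∈ openConnIn (φ '' S) (φ r) y}.Infinite} = 0 := by
  set μ := bondPercolation (zdGraph 3) (criticalProbI 3) with hμ
  -- the target event is the preimage of the source event under relabelling along `φ⁻¹`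
  have hpre : BondConfig.relabel (sym2Equiv φ.symm.toEquiv) ⁻¹' {ω | {y : Site 3 | ω ∈ openConnIn S r y}.Infinite} =
      {ω | {y : Site 3 | ω ∈ openConnIn (φ '' S) (φ r) y}.Infinite} := by
    ext ω
    simp only [Set.mem_preimage, Set.mem_setOf_eq]
    have hset : {y : Site 3 | BondConfig.relabel (sym2Equiv φ.symm.toEquiv) ω ∈ openConnIn S r y} =
        (φ : Site 3 → Site 3) ⁻¹' {y' : Site 3 | ω ∈ openConnIn (φ '' S) (φ r) y'} := by
      ext y
      simp only [Set.mem_setOf_eq, Set.mem_preimage]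
      constructor
      · intro hy
        have h1 := relabel_mem_openConnIn φ.toEquiv hy
        have hrel : BondConfig.relabel (sym2Equiv φ.toEquiv) (BondConfig.relabel (sym2Equiv φ.symm.toEquiv) ω) = ω := by
          have := relabel_symm_relabel φ.symm.toEquiv ω
          exact this
        rw [hrel] at h1
        exact h1
      · intro hy
        have h1 := relabel_mem_openConnIn φ.symm.toEquiv hy
        have hS : (φ.symm.toEquiv : Site 3 → Site 3) '' (φ '' S) = S := by
          ext z
          simp only [Set.mem_image, RelIso.coe_fn_toEquiv]
          constructor
          · rintro ⟨_, ⟨z', hz', rfl⟩, rfl⟩; simpa using hz'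
          · intro hz; exact ⟨φ z, ⟨z, hz, rfl⟩, by simp⟩
        have hr : (φ.symm.toEquiv : Site 3 → Site 3) (φ r) = r := by simp
        have hyy : (φ.symm.toEquiv : Site 3 → Site 3) (φ y) = y := by simp
        rw [hS, hr, hyy] at h1
        exact h1
    rw [hset]
    show ¬ ((φ : Site 3 → Site 3) ⁻¹' {y' : Site 3 | ω ∈ openConnIn (φ '' S) (φ r) y'}).Finite ↔
      ¬ ({y : Site 3 | ω ∈ openConnIn (φ '' S) (φ r) y}).Finite
    exact not_congr ⟨fun hf => hf.of_preimage φ.surjective, fun hf => hf.preimage φ.injective.injOn⟩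
  rw [← hpre]
  refine Measure.preimage_null_of_map_null (BondConfig.relabel _).measurable.aemeasurable ?_
  rw [bondPercolation_map_relabel_iso φ.symm]
  exact h

/-- A half-space and root presented as the image of the standard pair `({0 ≤ x_0}, t e₀)` under a lattice
automorphism has an a.s. finite cluster. -/
private theorem ae_finite_of_iso (φ : zdGraph 3 ≃g zdGraph 3) (t : ℕ) {S : Set (Site 3)} {v : Site 3}
    (hS : φ '' {x : Site 3 | 0 ≤ x 0} = S) (hv : φ ((Pi.single 0 ((t : ℕ) : ℤ) : Site 3)) = v) :
    ∀ᵐ ω ∂bondPercolation (zdGraph 3) (criticalProbI 3), {y : Site 3 | ω ∈ openConnIn S v y}.Finite := by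
  have h := measure_bad_image φ (measure_bad_axisPt t)
  rw [hS, hv] at h
  have := measure_eq_zero_iff_ae_notMem.1 h
  filter_upwards [this] with ω hω
  exact Set.not_infinite.1 hω

/-- If the root lies outside the region its cluster inside the region is empty. -/
private theorem setOf_openConnIn_eq_empty {S : Set (Site 3)} {v : Site 3} (hv : v ∉ S) (ω : BondConfig (Site 3)) :
    {y : Site 3 | ω ∈ openConnIn S v y} = ∅ := by
  ext y
  simp only [Set.mem_setOf_eq, Set.mem_empty_iff_false, iff_false]
  rintro ⟨hx, -, -⟩
  exact hv hx

/-- The automorphism `x ↦ signedPerm (swap 0 i) ε x + w`, pointwise. -/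
private theorem affIso_apply (i : Fin 3) (ε : Fin 3 → ℤˣ) (w x : Site 3) :
    ((zdSignedPermIso (Equiv.swap 0 i) ε).trans (zdShiftIso w)) x = Site.signedPerm (Equiv.swap 0 i) ε x + w := rfl

/-- The `i`-th coordinate of the image: `(φ x)_i = ε_i x_0 + w_i`. -/
private theorem affIso_apply_self (i : Fin 3) (ε : Fin 3 → ℤˣ) (w x : Site 3) :
    ((zdSignedPermIso (Equiv.swap 0 i) ε).trans (zdShiftIso w)) x i = (ε i : ℤ) * x 0 + w i := by
  rw [affIso_apply]
  simp [Site.signedPerm_apply, Equiv.symm_swap, Equiv.swap_apply_right]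

/-- The image of the axis point `t e₀`: `φ(t e₀) = ε_i t e_i + w`. -/
private theorem affIso_axisPt (i : Fin 3) (ε : Fin 3 → ℤˣ) (w : Site 3) (t : ℕ) (k : Fin 3) :
    ((zdSignedPermIso (Equiv.swap 0 i) ε).trans (zdShiftIso w)) ((Pi.single 0 ((t : ℕ) : ℤ) : Site 3)) k = (ε k : ℤ) * (Pi.single i (t : ℤ) : Site 3) k + w k := by
  rw [affIso_apply]
  simp only [Pi.add_apply, Site.signedPerm_apply, Equiv.symm_swap]
  congr 2
  by_cases hk : k = i
  · subst hk; simp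
  · have hne : Equiv.swap (0 : Fin 3) i k ≠ 0 := by
      rw [Ne, Equiv.swap_apply_eq_iff, Equiv.swap_apply_left]; exact hk
    simp [hne, hk]

/-- **Half-space clusters are a.s. finite, all at once.** -/
theorem ae_halfSpace_clusters_finite :
    ∀ᵐ ω ∂bondPercolation (zdGraph 3) (criticalProbI 3), ∀ (i : Fin 3) (a : ℤ) (v : Site 3),
      {y : Site 3 | ω ∈ openConnIn {x : Site 3 | a ≤ x i} v y}.Finite ∧
      {y : Site 3 | ω ∈ openConnIn {x : Site 3 | x i ≤ a} v y}.Finite := by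
  rw [ae_all_iff]; intro i
  rw [ae_all_iff]; intro a
  rw [ae_all_iff]; intro v
  refine Filter.Eventually.and ?_ ?_
  · -- the half-space `{a ≤ x_i}`
    by_cases hva : a ≤ v i
    · obtain ⟨t, ht⟩ : ∃ t : ℕ, v i = a + t := ⟨(v i - a).toNat, by omega⟩
      set w : Site 3 := v - Pi.single i (t : ℤ) with hw
      have hwi : w i = v i - t := by rw [hw]; simp
      refine ae_finite_of_iso (((zdSignedPermIso (Equiv.swap 0 i) 1).trans (zdShiftIso w))) t ?_ ?_
      · ext y
        simp only [Set.mem_image, Set.mem_setOf_eq]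
        constructor
        · rintro ⟨x, hx, rfl⟩
          rw [affIso_apply_self]
          simp only [Pi.one_apply, Units.val_one, one_mul]
          omega
        · intro hy
          refine ⟨(((zdSignedPermIso (Equiv.swap 0 i) 1).trans (zdShiftIso w))).symm y, ?_, RelIso.apply_symm_apply _ _⟩
          have e := affIso_apply_self i 1 w ((((zdSignedPermIso (Equiv.swap 0 i) 1).trans (zdShiftIso w))).symm y)
          rw [RelIso.apply_symm_apply] at e
          simp only [Pi.one_apply, Units.val_one, one_mul] at e
          omega
      · ext k
        rw [affIso_axisPt]
        simp only [Pi.one_apply, Units.val_one, one_mul, hw, Pi.sub_apply]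
        ring
    · filter_upwards with ω
      rw [setOf_openConnIn_eq_empty (by simpa using hva) ω]; exact Set.finite_empty
  · -- the half-space `{x_i ≤ a}`
    by_cases hva : v i ≤ a
    · obtain ⟨t, ht⟩ : ∃ t : ℕ, a = v i + t := ⟨(a - v i).toNat, by omega⟩
      set w : Site 3 := v + Pi.single i (t : ℤ) with hw
      have hwi : w i = v i + t := by rw [hw]; simp
      set ε : Fin 3 → ℤˣ := Function.update 1 i (-1) with hε
      have hεi : (ε i : ℤ) = -1 := by rw [hε]; simp
      have hεk : ∀ k, k ≠ i → (ε k : ℤ) = 1 := by intro k hk; rw [hε]; simp [hk]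
      refine ae_finite_of_iso (((zdSignedPermIso (Equiv.swap 0 i) ε).trans (zdShiftIso w))) t ?_ ?_
      · ext y
        simp only [Set.mem_image, Set.mem_setOf_eq]
        constructor
        · rintro ⟨x, hx, rfl⟩
          rw [affIso_apply_self, hεi]
          omega
        · intro hy
          refine ⟨(((zdSignedPermIso (Equiv.swap 0 i) ε).trans (zdShiftIso w))).symm y, ?_, RelIso.apply_symm_apply _ _⟩
          have e := affIso_apply_self i ε w ((((zdSignedPermIso (Equiv.swap 0 i) ε).trans (zdShiftIso w))).symm y)
          rw [RelIso.apply_symm_apply, hεi] at e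
          omega
      · ext k
        rw [affIso_axisPt]
        by_cases hk : k = i
        · subst hk
          rw [hεi, hw]
          simp
        · rw [hεk k hk, hw]
          simp [hk]
    · filter_upwards with ω
      rw [setOf_openConnIn_eq_empty (by simpa using hva) ω]; exact Set.finite_empty

/-! ## The item -/

/-- **`PercDustRigidity.BernoulliEnergyFKGPortrait` (stmt-CriticalPhenomena-9596), settled**: at `p_c(ℤ³)`,
insertion tolerance on boxes (constant `p_c^{|E(Λ_N)|}`), deletion tolerance (`(1-p_c)^{|E(Λ_N)|}`), the
Harris–FKG inequality, and a.s. finiteness of all half-space clusters. -/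
theorem bernoulliEnergyFKGPortrait_proof :
    Summit.CriticalPhenomena.PercolationContinuityZ3.Theses.PercDustRigidity.BernoulliEnergyFKGPortrait := by
  have hp0 : 0 < ((criticalProbI 3 : unitInterval) : ℝ) := by
    rw [coe_criticalProbI]; exact criticalProb_zd_pos 3 (by norm_num)
  have hp1 : ((criticalProbI 3 : unitInterval) : ℝ) < 1 := by
    rw [coe_criticalProbI]; exact criticalProb_zd_lt_one (by norm_num)
  refine ⟨?_, ?_, ?_, ae_halfSpace_clusters_finite⟩
  · -- insertion tolerance
    intro N
    set F := edgesIn (zdGraph 3) (box 3 N) with hF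
    have hFsub : (↑F : Set (Sym2 (Site 3))) ⊆ (zdGraph 3).edgeSet := by
      intro e he
      rw [Finset.mem_coe, hF, mem_edgesIn_iff] at he
      exact he.1
    refine ⟨((criticalProbI 3 : unitInterval) : ℝ) ^ F.card, pow_pos hp0 _, fun S hS => ?_⟩
    exact bondPercolation_pow_mul_real_preimage_openEdges_le (zdGraph 3) (criticalProbI 3) F hFsub hS
  · -- deletion tolerance
    intro N
    set F := edgesIn (zdGraph 3) (box 3 N) with hF
    refine ⟨(1 - ((criticalProbI 3 : unitInterval) : ℝ)) ^ F.card, pow_pos (by linarith) _, fun S hS => ?_⟩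
    exact bondPercolation_pow_mul_real_preimage_closeEdges_le (zdGraph 3) (criticalProbI 3) F hS
  · -- Harris–FKG, measure form
    intro A B hA hB hAm hBm
    set μ := bondPercolation (zdGraph 3) (criticalProbI 3) with hμ
    have h := harris_fkg_holds (zdGraph 3) (criticalProbI 3) hA hB hAm hBm
    rw [← ofReal_measureReal (measure_ne_top μ A), ← ofReal_measureReal (measure_ne_top μ B),
      ← ofReal_measureReal (measure_ne_top μ (A ∩ B)), ← ENNReal.ofReal_mul measureReal_nonneg]
    exact ENNReal.ofReal_le_ofReal h

/-- **Upper half-space clusters are a.s. finite at `p_c(ℤ³)`** (one direction of the portrait's last clause,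
extracted for users): for every `i`, `a`, `v`, almost surely the open cluster of `v` inside `{a ≤ x_i}` is finite. -/
theorem ae_upper_halfSpace_cluster_finite (i : Fin 3) (a : ℤ) (v : Site 3) :
    ∀ᵐ ω ∂bondPercolation (zdGraph 3) (criticalProbI 3),
      {y : Site 3 | ω ∈ openConnIn {x : Site 3 | a ≤ x i} v y}.Finite := by
  filter_upwards [ae_halfSpace_clusters_finite] with ω hω
  exact (hω i a v).1

end Summit.CriticalPhenomena.PercolationContinuityZ3.Theorems.BernoulliPortrait
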